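import Literature.NumberTheory.EllipticCurves.KugaSatoSchollProjectorComponents
import HarnessLib

/-!
# The `K`-side Betti cohomology of a Kuga–Sato variety is the `σ₀`-component of `Hⁱ_B(W|_ℚ)`

Topic: `Literature/NumberTheory/EllipticCurves`. The tree carries Scholl's projector `Π_ε` on two
Betti cohomologies of a Kuga–Sato variety `V : KugaSatoVariety K m N`:
`KugaSatoSchollProjectorBetti(SL).lean` work with `Hⁱ_B(W) = Hⁱ(W(ℂ); ℚ)` for `W` over `K ⊆ ℂ`
(an instance `[Algebra K ℂ]`, i.e. a chosen embedding `σ₀ : K → ℂ`), while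
`KugaSatoSchollProjectorFrobInfty/Components(FrobInfty)/FrobInftySign.lean` work with Scholl's
`ℚ`-scheme `W|_ℚ` and its conjugate components `W_σ = W ⊗_{K,σ} ℂ`,
`Hⁱ_B(W|_ℚ) ≅ ∏_σ Hⁱ_B(W_σ)`. This file identifies the two pictures: `W(ℂ)` (points along `σ₀`)
is homeomorphic to `W_{σ₀}(ℂ)` (`Motives.AlgPoints.alongHomeomorphBaseChange`, from
`AlgPoints.isHomeomorph_baseChangeEquiv_holds`), equivariantly for `Aut W`, so that

* `instEmb K : K →ₐ[ℚ] ℂ` — the embedding `σ₀` underlying `[Algebra K ℂ]`;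
* `AlgPoints.baseChangeEquiv_map` / `alongHomeomorph_comp_mapContinuous` — the identification
  `Z(ℂ) ≃ₜ Z_{σ₀}(ℂ)` is natural in the `K`-scheme `Z` (universal property of the fibre product);
* `map_alongHomeomorph_bettiActionConj` — on cohomology, `h* : Hⁱ_B(W_{σ₀}) → Hⁱ_B(W)` intertwines
  the actions of `ℚ[Aut W]` (`bettiActionConj V σ₀` of `…Components` and `bettiAction V` of
  `…Betti`), hence Scholl's projector (`map_alongHomeomorph_schollProjectorBettiConj`);
* `schollPartConjEquiv V i : Π_ε Hⁱ_B(W_{σ₀}) ≃ₗ[ℚ] Π_ε Hⁱ_B(W)` — **the `ε`-part of the `K`-side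
  cohomology is the `σ₀`-component of the `ε`-part of `Hⁱ_B(W|_ℚ)`** (combine with
  `schollPartRatEquiv` of `…Components`).

Deninger–Scholl 1991, §4.1/5.1: Scholl's `X̄̄_nʷ/ℚ` versus its `φ(n)` geometric components; no
named facts; hypothesis `[IsCommMonObj V.curve.E]` as in the companion files.

## References

* C. Deninger, A. J. Scholl, *The Beilinson conjectures*, in *L-functions and Arithmetic*,
  LMS LNS 153 (1991), §4.1 (p. 161 of the volume), 5.1, 5.3 (i) (p. 167). [DeningerScholl1991]
* R. Hartshorne, *Algebraic Geometry*, II.3 Thm. 3.3 (points of a fibre product). [Hartshorne1977]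
-/

open CategoryTheory Limits AlgebraicGeometry MonoidalCategory CartesianMonoidalCategory
open scoped MonObj MatrixGroups

noncomputable section

namespace Literature.NumberTheory.EllipticCurves

open Literature.AlgebraicGeometry.Motives Literature.AlgebraicTopology.SingularHomology

/-! ### The embedding underlying an `[Algebra K ℂ]` instance -/

/-- The `ℚ`-embedding `σ₀ : K → ℂ` underlying an `[Algebra K ℂ]` instance on a field of
characteristic zero (its `algebraMap`, which commutes with the rational scalars). [folklore] -/
def instEmb (K : Type) [Field K] [CharZero K] [Algebra K ℂ] : K →ₐ[ℚ] ℂ :=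
  { algebraMap K ℂ with
    commutes' := fun q => by
      change algebraMap K ℂ (algebraMap ℚ K q) = algebraMap ℚ ℂ q
      rw [show algebraMap ℚ K q = (q : K) from rfl, show algebraMap ℚ ℂ q = (q : ℂ) from rfl,
        map_ratCast] }

/-- `instEmb K` is `algebraMap K ℂ` as a ring homomorphism (by `rfl`). [folklore] -/
theorem instEmb_toRingHom (K : Type) [Field K] [CharZero K] [Algebra K ℂ] :
    (instEmb K).toRingHom = algebraMap K ℂ :=
  rfl

/-! ### Naturality of `Z(ℂ) ≃ Z_σ(ℂ)` in the `K`-scheme `Z` -/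

section Naturality

variable {K : Type} [Field K] (σ : K →+* ℂ) {Z Z' : SchemeOver K}

/-- **`X(L) ≃ X_σ(L)` is natural in `X`**: for a `K`-morphism `φ : Z ⟶ Z'` and an `L`-point `P` of
`Z` along `σ`, the point of `Z'_σ` attached to `φ(P)` is `φ_σ` of the point attached to `P`
(universal property of the fibre product, Hartshorne II.3 Thm. 3.3; checked on the two projections
with `baseChangeEquiv_apply_left_comp_fst` and `baseChangeHom_map_left_comp_fst`).
[cite: Hartshorne1977, II.3 Thm. 3.3] -/
theorem AlgPoints.baseChangeEquiv_map (φ : Z ⟶ Z') (P : letI := σ.toAlgebra; AlgPoints Z ℂ) :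
    (letI := σ.toAlgebra; AlgPoints.baseChangeEquiv σ Z' (AlgPoints.map φ P)) =
      AlgPoints.map ((baseChangeHom σ).map φ) (AlgPoints.baseChangeEquiv σ Z P) := by
  letI := σ.toAlgebra
  apply Over.OverMorphism.ext
  apply pullback.hom_ext
  · change (AlgPoints.baseChangeEquiv σ Z' (AlgPoints.map φ P)).left ≫ baseChangeHomFst σ Z' =
      (AlgPoints.map ((baseChangeHom σ).map φ) (AlgPoints.baseChangeEquiv σ Z P)).left ≫
        baseChangeHomFst σ Z'
    have h1 := AlgPoints.baseChangeEquiv_apply_left_comp_fst σ Z' (AlgPoints.map φ P)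
    have h2 := AlgPoints.baseChangeEquiv_apply_left_comp_fst σ Z P
    have h3 := baseChangeHom_map_left_comp_fst σ φ
    rw [h1, AlgPoints.map_apply, Over.comp_left, AlgPoints.map_apply, Over.comp_left, ← h2]
    simp only [Category.assoc]
    rw [h3]
    exact Category.assoc (obj := Scheme) _ _ _
  · change (AlgPoints.baseChangeEquiv σ Z' (AlgPoints.map φ P)).left ≫
        ((baseChangeHom σ).obj Z').hom =
      (AlgPoints.map ((baseChangeHom σ).map φ) (AlgPoints.baseChangeEquiv σ Z P)).left ≫
        ((baseChangeHom σ).obj Z').hom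
    rw [Over.w, Over.w]

/-- The same as an identity of continuous maps `Z(ℂ) → Z'_σ(ℂ)` for the bundled homeomorphism
`alongHomeomorphBaseChange` (`k = ℚ`, `σ : K →ₐ[ℚ] ℂ`). [cite: Hartshorne1977, II.3 Thm. 3.3] -/
theorem alongHomeomorph_comp_mapContinuous [CharZero K] (τ : K →ₐ[ℚ] ℂ) (φ : Z ⟶ Z') :
    (letI := τ.toRingHom.toAlgebra;
      ((AlgPoints.alongHomeomorphBaseChange Z' τ : C(AlgPoints Z' ℂ,
          ComplexPoints ((baseChangeHom τ.toRingHom).obj Z'))).comp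
        (AlgPoints.mapContinuous (L := ℂ) φ) :
        C(AlgPoints Z ℂ, ComplexPoints ((baseChangeHom τ.toRingHom).obj Z')))) =
      (letI := τ.toRingHom.toAlgebra;
        (AlgPoints.mapContinuous (L := ℂ) ((baseChangeHom τ.toRingHom).map φ)).comp
          (AlgPoints.alongHomeomorphBaseChange Z τ : C(AlgPoints Z ℂ,
            ComplexPoints ((baseChangeHom τ.toRingHom).obj Z)))) := by
  letI := τ.toRingHom.toAlgebra
  ext P : 1
  exact AlgPoints.baseChangeEquiv_map τ.toRingHom φ P

end Naturality

namespace KugaSatoVariety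

variable {K : Type} [Field K] [NumberField K] [Algebra K ℂ] {m N : ℕ} (V : KugaSatoVariety K m N)

/-! ### `W(ℂ) ≃ₜ W_{σ₀}(ℂ)` and the two actions of `ℚ[Aut W]` -/

/-- **`W(ℂ) ≃ₜ W_{σ₀}(ℂ)`**: the complex points of `W` through the given embedding `K ⊆ ℂ` are the
complex points of the conjugate component `W_{σ₀}`, `σ₀ = instEmb K`
(`Motives.AlgPoints.alongHomeomorphBaseChange`; the two sides are the same type of points since
`(instEmb K).toRingHom = algebraMap K ℂ`). [folklore] -/
def alongHomeomorph : ComplexPoints V.W ≃ₜ ComplexPoints (V.conj (instEmb K)) :=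
  AlgPoints.alongHomeomorphBaseChange V.W (instEmb K)

/-- `alongHomeomorph` intertwines `g(ℂ)` on `W(ℂ)` and `g_{σ₀}(ℂ)` on `W_{σ₀}(ℂ)` for every
`K`-endomorphism `φ` of `W`. [folklore] -/
theorem alongHomeomorph_comp_mapContinuous (φ : V.W ⟶ V.W) :
    (V.alongHomeomorph : C(ComplexPoints V.W, ComplexPoints (V.conj (instEmb K)))).comp
        (AlgPoints.mapContinuous (L := ℂ) φ) =
      (AlgPoints.mapContinuous (L := ℂ) ((baseChangeHom (instEmb K).toRingHom).map φ)).comp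
        (V.alongHomeomorph : C(ComplexPoints V.W, ComplexPoints (V.conj (instEmb K)))) :=
  Literature.NumberTheory.EllipticCurves.alongHomeomorph_comp_mapContinuous (instEmb K) φ

/-- **`h* : Hⁱ_B(W_{σ₀}) → Hⁱ_B(W)` intertwines the two actions of `ℚ[Aut W]`**
(`bettiActionConj V σ₀` on the component, `bettiAction V` on the `K`-side cohomology of
`KugaSatoSchollProjectorBetti.lean`). [cite: DeningerScholl1991, §4.1 and 5.3 (i)] -/
theorem map_alongHomeomorph_bettiActionConj (i : ℕ) (a : MonoidAlgebra ℚ (Aut V.W))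
    (y : bettiCohomology (V.conj (instEmb K)) i) :
    singularCohomology.map ℚ ℚ
        (V.alongHomeomorph : C(ComplexPoints V.W, ComplexPoints (V.conj (instEmb K)))) i
        (V.bettiActionConj (instEmb K) i a y) =
      V.bettiAction i a (singularCohomology.map ℚ ℚ
        (V.alongHomeomorph : C(ComplexPoints V.W, ComplexPoints (V.conj (instEmb K)))) i y) := by
  induction a using MonoidAlgebra.induction_on with
  | hM g =>
    rw [bettiActionConj_of, bettiAction_of]
    have h := singularCohomology.map_comp ℚ ℚ
      (V.alongHomeomorph : C(ComplexPoints V.W, ComplexPoints (V.conj (instEmb K))))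
      (AlgPoints.mapContinuous (L := ℂ) ((baseChangeHom (instEmb K).toRingHom).map g.inv)) i
    have h' := singularCohomology.map_comp ℚ ℚ (AlgPoints.mapContinuous (L := ℂ) g.inv)
      (V.alongHomeomorph : C(ComplexPoints V.W, ComplexPoints (V.conj (instEmb K)))) i
    rw [V.alongHomeomorph_comp_mapContinuous g.inv, h] at h'
    exact LinearMap.congr_fun (ModuleCat.hom_ext_iff.mp h') y
  | hadd a b ha hb =>
    rw [map_add, map_add, LinearMap.add_apply, LinearMap.add_apply, map_add, ha, hb]
  | hsmul r a ha =>
    rw [map_smul, map_smul, LinearMap.smul_apply, LinearMap.smul_apply, map_smul, ha]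

/-- **`h*` intertwines Scholl's projector** on `Hⁱ_B(W_{σ₀})` and on `Hⁱ_B(W)`.
[cite: DeningerScholl1991, §4.1 and 5.3 (i)] -/
theorem map_alongHomeomorph_schollProjectorBettiConj [NeZero N] [IsCommMonObj V.curve.E] (i : ℕ)
    (y : bettiCohomology (V.conj (instEmb K)) i) :
    singularCohomology.map ℚ ℚ
        (V.alongHomeomorph : C(ComplexPoints V.W, ComplexPoints (V.conj (instEmb K)))) i
        (V.schollProjectorBettiConj (instEmb K) i y) =
      V.schollProjectorBetti i (singularCohomology.map ℚ ℚ
        (V.alongHomeomorph : C(ComplexPoints V.W, ComplexPoints (V.conj (instEmb K)))) i y) :=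
  V.map_alongHomeomorph_bettiActionConj i V.schollProjector y

/-- `h*` carries the `ε`-part of `Hⁱ_B(W_{σ₀})` into the `ε`-part of `Hⁱ_B(W)`.
[cite: DeningerScholl1991, §4.1 and 5.3 (i)] -/
theorem map_alongHomeomorph_mem_schollPart [NeZero N] [IsCommMonObj V.curve.E] {i : ℕ}
    {y : bettiCohomology (V.conj (instEmb K)) i} (hy : y ∈ V.schollPartConj (instEmb K) i) :
    singularCohomology.map ℚ ℚ
        (V.alongHomeomorph : C(ComplexPoints V.W, ComplexPoints (V.conj (instEmb K)))) i y ∈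
      V.schollPart i := by
  rw [mem_schollPartConj_iff] at hy
  rw [mem_schollPart_iff, ← map_alongHomeomorph_schollProjectorBettiConj, hy]

/-- `(h⁻¹)*` carries the `ε`-part of `Hⁱ_B(W)` into the `ε`-part of `Hⁱ_B(W_{σ₀})`.
[cite: DeningerScholl1991, §4.1 and 5.3 (i)] -/
theorem map_alongHomeomorph_symm_mem_schollPartConj [NeZero N] [IsCommMonObj V.curve.E] {i : ℕ}
    {x : bettiCohomology V.W i} (hx : x ∈ V.schollPart i) :
    singularCohomology.map ℚ ℚ
        (V.alongHomeomorph.symm : C(ComplexPoints (V.conj (instEmb K)), ComplexPoints V.W)) i x ∈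
      V.schollPartConj (instEmb K) i := by
  rw [mem_schollPartConj_iff]
  apply ((singularCohomology.mapIso (R := ℚ) (M := ℚ) V.alongHomeomorph i).toLinearEquiv).injective
  change singularCohomology.map ℚ ℚ
      (V.alongHomeomorph : C(ComplexPoints V.W, ComplexPoints (V.conj (instEmb K)))) i
      (V.schollProjectorBettiConj (instEmb K) i _) =
    singularCohomology.map ℚ ℚ
      (V.alongHomeomorph : C(ComplexPoints V.W, ComplexPoints (V.conj (instEmb K)))) i _
  rw [map_alongHomeomorph_schollProjectorBettiConj]
  have hinv : singularCohomology.map ℚ ℚ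
      (V.alongHomeomorph : C(ComplexPoints V.W, ComplexPoints (V.conj (instEmb K)))) i
      (singularCohomology.map ℚ ℚ
        (V.alongHomeomorph.symm : C(ComplexPoints (V.conj (instEmb K)), ComplexPoints V.W)) i x) =
      x := by
    change ((singularCohomology.mapIso (R := ℚ) (M := ℚ) V.alongHomeomorph i).inv ≫
      (singularCohomology.mapIso (R := ℚ) (M := ℚ) V.alongHomeomorph i).hom) x = x
    rw [Iso.inv_hom_id]
    rfl
  rw [hinv]
  exact (V.mem_schollPart_iff i x).mp hx

/-- **The `ε`-part of the `K`-side cohomology `Hⁱ_B(W)` is the `σ₀`-component of the `ε`-part of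
`Hⁱ_B(W|_ℚ)`**: `Π_ε Hⁱ_B(W_{σ₀}) ≃ₗ[ℚ] Π_ε Hⁱ_B(W)`, the restriction of `h*` (combine with
`schollPartRatEquiv : Π_ε Hⁱ_B(W|_ℚ) ≃ₗ ∏_σ Π_ε Hⁱ_B(W_σ)` of `KugaSatoSchollProjectorComponents`;
Deninger–Scholl §4.1, 5.1–5.3: the cohomology of Scholl's `ℚ`-scheme versus that of one geometric
component). [cite: DeningerScholl1991, §4.1 and 5.3 (i)] -/
def schollPartConjEquiv [NeZero N] [IsCommMonObj V.curve.E] (i : ℕ) :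
    V.schollPartConj (instEmb K) i ≃ₗ[ℚ] V.schollPart i where
  toFun y := ⟨singularCohomology.map ℚ ℚ
      (V.alongHomeomorph : C(ComplexPoints V.W, ComplexPoints (V.conj (instEmb K)))) i
      (y : bettiCohomology (V.conj (instEmb K)) i), V.map_alongHomeomorph_mem_schollPart y.2⟩
  map_add' y z := by
    apply Subtype.ext
    exact map_add (singularCohomology.map ℚ ℚ
      (V.alongHomeomorph : C(ComplexPoints V.W, ComplexPoints (V.conj (instEmb K)))) i).hom
      (y : bettiCohomology (V.conj (instEmb K)) i) (z : bettiCohomology (V.conj (instEmb K)) i)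
  map_smul' r y := by
    apply Subtype.ext
    exact map_smul (singularCohomology.map ℚ ℚ
      (V.alongHomeomorph : C(ComplexPoints V.W, ComplexPoints (V.conj (instEmb K)))) i).hom
      r (y : bettiCohomology (V.conj (instEmb K)) i)
  invFun x := ⟨singularCohomology.map ℚ ℚ
      (V.alongHomeomorph.symm : C(ComplexPoints (V.conj (instEmb K)), ComplexPoints V.W)) i
      (x : bettiCohomology V.W i), V.map_alongHomeomorph_symm_mem_schollPartConj x.2⟩
  left_inv y := by
    apply Subtype.ext
    change ((singularCohomology.mapIso (R := ℚ) (M := ℚ) V.alongHomeomorph i).hom ≫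
      (singularCohomology.mapIso (R := ℚ) (M := ℚ) V.alongHomeomorph i).inv)
        (y : bettiCohomology (V.conj (instEmb K)) i) = (y : bettiCohomology _ i)
    rw [Iso.hom_inv_id]
    rfl
  right_inv x := by
    apply Subtype.ext
    change ((singularCohomology.mapIso (R := ℚ) (M := ℚ) V.alongHomeomorph i).inv ≫
      (singularCohomology.mapIso (R := ℚ) (M := ℚ) V.alongHomeomorph i).hom)
        (x : bettiCohomology V.W i) = (x : bettiCohomology V.W i)
    rw [Iso.inv_hom_id]
    rfl

/-- The underlying class of `schollPartConjEquiv y` is `h* y`. [folklore] -/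
@[simp]
theorem schollPartConjEquiv_apply_coe [NeZero N] [IsCommMonObj V.curve.E] (i : ℕ)
    (y : V.schollPartConj (instEmb K) i) :
    (V.schollPartConjEquiv i y : bettiCohomology V.W i) =
      singularCohomology.map ℚ ℚ
        (V.alongHomeomorph : C(ComplexPoints V.W, ComplexPoints (V.conj (instEmb K)))) i
        (y : bettiCohomology (V.conj (instEmb K)) i) :=
  rfl

end KugaSatoVariety

end Literature.NumberTheory.EllipticCurves

end
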